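import Literature.AlgebraicGeometry.Motives.MixedHodgeStructureEndAlgPi
import Literature.AlgebraicGeometry.Motives.MixedHodgeStructureBidual
import Mathlib.Algebra.Algebra.Opposite
import Mathlib.RingTheory.SimpleModule.WedderburnArtin
import Mathlib.RingTheory.SimpleRing.Congr
import HarnessLib

/-!
# Duality for endomorphism algebras of mixed Hodge structures: `End_MHS(H^∨) ≅ End_MHS(H)ᵒᵖ`

Cattani–El Zein–Griffiths–Lê, *Hodge Theory*, §3.2.2.7: the dual `H^*` of a mixed Hodge structure is an MHS (Deligne, *Hodge II*,
1.1.6–1.1.7), and the transpose of a morphism is a morphism (the tree's `Hom.transpose`, `Motives/MixedHodgeStructureDual`);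
Fujiki, *Duality of mixed Hodge structures* (1980), (1.6.2) a): `H ≅ H^∨∨` as MHS (the tree's `Hom.bidual`,
`Motives/MixedHodgeStructureBidual`). Consequently **transposition `a ↦ a^∨` is an anti-isomorphism of `ℚ`-algebras
`End_MHS(H) → End_MHS(H^∨)`** — the MHS case of the general fact that a duality on an additive category induces
`End(X^∨) ≅ End(X)ᵒᵖ` (Lam, *A First Course in Noncommutative Rings*, (1.12)–(1.13) and Prop. 3.1.10-style computations of
`End` via opposite rings; Beachy Prop. 3.1.10 (a): `End_R(R) ≅ Rᵒᵖ`). This file proves, for `H` on a finite-dimensional `V`: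

* §1 **`endAlg.transposeAlgEquiv H : End_MHS(H) ≃ₐ[ℚ] End_MHS(H^∨)ᵐᵒᵖ`**, `a ↦ op(a^∨)` (`(ab)^∨ = b^∨ a^∨`); injectivity by
  biduality (`a^∨∨ ∘ i = i ∘ a`), surjectivity by the dimension squeeze `dim End(H) ≤ dim End(H^∨) ≤ dim End(H^∨∨) = dim End(H)`;
  also `endAlg.dualAlgEquivOp : End_MHS(H^∨) ≃ₐ[ℚ] End_MHS(H)ᵐᵒᵖ` and `dim_ℚ End_MHS(H^∨) = dim_ℚ End_MHS(H)`.
* §2 consequences: `End_MHS(H^∨)` is commutative / a semisimple ring / a simple ring / a local ring / reduced iff `End_MHS(H)` is;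
  units correspond (`Aut(H^∨) ≅ Aut(H)ᵒᵖ`).

All statements proved; the definitions are the displayed maps; no named facts, no instances.

## References

* [CattaniElZeinGriffithsLe2014] E. Cattani et al. (eds.), Hodge Theory (2014), §3.2.2.7 (p. 163), Thm. 3.2.18.
* [Fujiki1980] A. Fujiki, Duality of mixed Hodge structures of algebraic varieties, Publ. RIMS 16 (1980), (1.6.2) a).
* [Beachy1999RingsModules] J. A. Beachy, Introductory Lectures on Rings and Modules (1999), Prop. 3.1.10 (a) (held text p0137:
  `End_R(R)` is isomorphic to the opposite ring `R^{op}`).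
* [Lam2001FirstCourse] T. Y. Lam, A First Course in Noncommutative Rings, 2nd ed. (2001), (1.12)–(1.13).
-/

noncomputable section

namespace Literature.AlgebraicGeometry.Motives

namespace MixedHodgeStructure

open Module

universe u

variable {V : Type u} [AddCommGroup V] [Module ℚ V] [FiniteDimensional ℚ V] (H : MixedHodgeStructure V)

/-! ### §1 Transposition `End_MHS(H) → End_MHS(H^∨)ᵒᵖ` -/

/-- **Transposition on endomorphisms**, `a ↦ a^∨`, a `ℚ`-linear map `End_MHS(H) → End_MHS(H^∨)` (anti-multiplicative).
[cite: CattaniElZeinGriffithsLe2014, §3.2.2.7] -/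
def endAlg.transposeLinear : H.endAlg →ₗ[ℚ] H.dual.endAlg where
  toFun a := (endAlg.toHom a).transpose.toEndAlg
  map_add' a b := Subtype.ext (by
    change ((a + b : H.endAlg) : Module.End ℚ V).dualMap = (a : Module.End ℚ V).dualMap + (b : Module.End ℚ V).dualMap
    rw [Subalgebra.coe_add]
    exact map_add (Module.Dual.transpose (R := ℚ)) _ _)
  map_smul' q a := Subtype.ext (by
    change ((q • a : H.endAlg) : Module.End ℚ V).dualMap = q • (a : Module.End ℚ V).dualMap
    rw [Subalgebra.coe_smul]
    exact map_smul (Module.Dual.transpose (R := ℚ)) _ _)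

/-- Underlying map of `a^∨` (by `rfl`). [cite: CattaniElZeinGriffithsLe2014, §3.2.2.7] -/
@[simp]
theorem endAlg.coe_transposeLinear_apply (a : H.endAlg) :
    ((endAlg.transposeLinear H a : H.dual.endAlg) : Module.End ℚ (Module.Dual ℚ V)) = (a : Module.End ℚ V).dualMap := rfl

/-- `(a^∨ φ) v = φ (a v)` (by `rfl`). [cite: CattaniElZeinGriffithsLe2014, §3.2.2.7] -/
theorem endAlg.transposeLinear_apply_apply (a : H.endAlg) (φ : Module.Dual ℚ V) (v : V) :
    ((endAlg.transposeLinear H a : H.dual.endAlg) : Module.End ℚ (Module.Dual ℚ V)) φ v = φ ((a : Module.End ℚ V) v) := rfl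

/-- `1^∨ = 1`. [cite: CattaniElZeinGriffithsLe2014, §3.2.2.7] -/
theorem endAlg.transposeLinear_one : endAlg.transposeLinear H 1 = 1 :=
  Subtype.ext (congrArg Hom.toLinearMap (Hom.transpose_id (H₁ := H)))

/-- **`(a b)^∨ = b^∨ a^∨`.** [cite: CattaniElZeinGriffithsLe2014, §3.2.2.7] -/
theorem endAlg.transposeLinear_mul (a b : H.endAlg) :
    endAlg.transposeLinear H (a * b) = endAlg.transposeLinear H b * endAlg.transposeLinear H a :=
  Subtype.ext (congrArg Hom.toLinearMap (Hom.transpose_comp (endAlg.toHom a) (endAlg.toHom b)))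

/-- **Transposition is injective on `End_MHS(H)`** (biduality: `a^∨∨ ∘ i_V = i_V ∘ a` with `i_V` injective).
[cite: Fujiki1980, (1.6.2) a)] -/
theorem endAlg.transposeLinear_injective : Function.Injective (endAlg.transposeLinear H) := fun a b hab => by
  have h : (endAlg.toHom a).transpose = (endAlg.toHom b).transpose := Hom.ext (congrArg Subtype.val hab)
  have ha := Hom.transpose_transpose_comp_bidual (endAlg.toHom a)
  have hb := Hom.transpose_transpose_comp_bidual (endAlg.toHom b)
  rw [h, hb] at ha
  -- `i ∘ b = i ∘ a`
  refine Subtype.ext (LinearMap.ext fun v => (Hom.bidual_bijective H).1 ?_)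
  have h1 := congrArg (fun f : Hom H H.dual.dual => f.toLinearMap v) ha
  simpa only [Hom.comp_toLinearMap, LinearMap.comp_apply, endAlg.toHom_toLinearMap] using h1.symm

/-- **`dim_ℚ End_MHS(H) ≤ dim_ℚ End_MHS(H^∨)`** (transposition is injective). [cite: Fujiki1980, (1.6.2) a)] -/
theorem finrank_endAlg_le_finrank_endAlg_dual : finrank ℚ H.endAlg ≤ finrank ℚ H.dual.endAlg := by
  haveI := finiteDimensional_endAlg H.dual
  exact LinearMap.finrank_le_finrank_of_injective (endAlg.transposeLinear_injective H)

/-- **`dim_ℚ End_MHS(H^∨) = dim_ℚ End_MHS(H)`** (squeeze with `H ≅ H^∨∨`). [cite: Fujiki1980, (1.6.2) a)] -/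
theorem finrank_endAlg_dual : finrank ℚ H.dual.endAlg = finrank ℚ H.endAlg :=
  le_antisymm ((finrank_endAlg_le_finrank_endAlg_dual H.dual).trans
    (finrank_endAlg_eq_of_iso (Hom.bidual H) (Hom.bidual_bijective H)).symm.le) (finrank_endAlg_le_finrank_endAlg_dual H)

/-- **Transposition is surjective on `End_MHS(H)`**: `b ∈ End_MHS(H^∨)` is the transpose of `a = i⁻¹ ∘ b^∨ ∘ i`
(`a^∨∨ ∘ i = i ∘ a = b^∨ ∘ i`, then cancel one transposition). [cite: Fujiki1980, (1.6.2) a)] -/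
theorem endAlg.transposeLinear_surjective : Function.Surjective (endAlg.transposeLinear H) := fun b => by
  refine ⟨((Hom.bidualInv H).comp ((endAlg.toHom b).transpose.comp (Hom.bidual H))).toEndAlg, ?_⟩
  apply endAlg.transposeLinear_injective H.dual
  refine Subtype.ext (LinearMap.ext fun ψ => LinearMap.ext fun φ => ?_)
  obtain ⟨v, rfl⟩ := (Hom.bidual_bijective H).2 ψ
  have h := congrArg (fun f : Hom H.dual.dual H.dual.dual =>
    f.toLinearMap ((endAlg.toHom b).transpose.toLinearMap ((Hom.bidual H).toLinearMap v)) φ) (Hom.bidual_comp_bidualInv H)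
  exact h

/-- Transposition `End_MHS(H) → End_MHS(H^∨)` is bijective. [cite: Fujiki1980, (1.6.2) a)] -/
theorem endAlg.transposeLinear_bijective : Function.Bijective (endAlg.transposeLinear H) :=
  ⟨endAlg.transposeLinear_injective H, endAlg.transposeLinear_surjective H⟩

/-- **Transposition as a homomorphism of `ℚ`-algebras `End_MHS(H) → End_MHS(H^∨)ᵐᵒᵖ`.** [cite: CattaniElZeinGriffithsLe2014, §3.2.2.7]
[cite: Beachy1999RingsModules, Prop. 3.1.10 (a)] -/
def endAlg.transposeHom : H.endAlg →ₐ[ℚ] (H.dual.endAlg)ᵐᵒᵖ where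
  toFun a := MulOpposite.op (endAlg.transposeLinear H a)
  map_one' := by rw [endAlg.transposeLinear_one, MulOpposite.op_one]
  map_mul' a b := by rw [endAlg.transposeLinear_mul, MulOpposite.op_mul]
  map_zero' := by rw [map_zero, MulOpposite.op_zero]
  map_add' a b := by rw [map_add, MulOpposite.op_add]
  commutes' q := by
    rw [Algebra.algebraMap_eq_smul_one, map_smul, endAlg.transposeLinear_one, Algebra.algebraMap_eq_smul_one,
      MulOpposite.op_smul, MulOpposite.op_one]

/-- `transposeHom a = op (a^∨)` (by `rfl`). [cite: CattaniElZeinGriffithsLe2014, §3.2.2.7] -/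
@[simp]
theorem endAlg.transposeHom_apply (a : H.endAlg) : endAlg.transposeHom H a = MulOpposite.op (endAlg.transposeLinear H a) := rfl

/-- **`End_MHS(H) ≃ₐ[ℚ] End_MHS(H^∨)ᵐᵒᵖ`**: transposition is an anti-isomorphism of the endomorphism algebras.
[cite: CattaniElZeinGriffithsLe2014, §3.2.2.7] [cite: Fujiki1980, (1.6.2) a)] [cite: Beachy1999RingsModules, Prop. 3.1.10 (a)] -/
def endAlg.transposeAlgEquiv : H.endAlg ≃ₐ[ℚ] (H.dual.endAlg)ᵐᵒᵖ :=
  AlgEquiv.ofBijective (endAlg.transposeHom H)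
    ⟨fun _ _ hab => (endAlg.transposeLinear_bijective H).1 (MulOpposite.op_injective hab),
      fun b => by
        obtain ⟨a, ha⟩ := (endAlg.transposeLinear_bijective H).2 (MulOpposite.unop b)
        exact ⟨a, by rw [endAlg.transposeHom_apply, ha, MulOpposite.op_unop]⟩⟩

/-- `transposeAlgEquiv a = op (a^∨)` (by `rfl`). [cite: CattaniElZeinGriffithsLe2014, §3.2.2.7] -/
@[simp]
theorem endAlg.transposeAlgEquiv_apply (a : H.endAlg) :
    endAlg.transposeAlgEquiv H a = MulOpposite.op (endAlg.transposeLinear H a) := rfl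

/-- **`End_MHS(H^∨) ≃ₐ[ℚ] End_MHS(H)ᵐᵒᵖ`.** [cite: CattaniElZeinGriffithsLe2014, §3.2.2.7] [cite: Fujiki1980, (1.6.2) a)] -/
def endAlg.dualAlgEquivOp : H.dual.endAlg ≃ₐ[ℚ] (H.endAlg)ᵐᵒᵖ :=
  (AlgEquiv.opOp ℚ H.dual.endAlg).trans (AlgEquiv.op (endAlg.transposeAlgEquiv H)).symm

/-- As rings: `End_MHS(H^∨) ≃+* End_MHS(H)ᵐᵒᵖ`. [cite: CattaniElZeinGriffithsLe2014, §3.2.2.7] -/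
def endAlg.dualRingEquivOp : H.dual.endAlg ≃+* (H.endAlg)ᵐᵒᵖ :=
  (endAlg.dualAlgEquivOp H).toRingEquiv

/-! ### §2 Ring-theoretic properties shared by `End_MHS(H)` and `End_MHS(H^∨)` -/

/-- `(a^n)^∨ = (a^∨)^n`. [cite: CattaniElZeinGriffithsLe2014, §3.2.2.7] -/
theorem endAlg.transposeLinear_pow (a : H.endAlg) (n : ℕ) :
    endAlg.transposeLinear H (a ^ n) = endAlg.transposeLinear H a ^ n := by
  induction n with
  | zero => rw [pow_zero, pow_zero, endAlg.transposeLinear_one]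
  | succ n ih => rw [pow_succ, endAlg.transposeLinear_mul, ih, ← pow_succ']

/-- `a^∨` is nilpotent iff `a` is. [cite: CattaniElZeinGriffithsLe2014, §3.2.2.7] -/
theorem endAlg.isNilpotent_transposeLinear_iff (a : H.endAlg) : IsNilpotent (endAlg.transposeLinear H a) ↔ IsNilpotent a :=
  ⟨fun ⟨n, hn⟩ => ⟨n, endAlg.transposeLinear_injective H (by rw [endAlg.transposeLinear_pow, hn, map_zero])⟩,
    fun ⟨n, hn⟩ => ⟨n, by rw [← endAlg.transposeLinear_pow, hn, map_zero]⟩⟩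

/-- `a^∨` is a unit iff `a` is: **`Aut_MHS(H^∨) ≅ Aut_MHS(H)ᵒᵖ`.** [cite: CattaniElZeinGriffithsLe2014, §3.2.2.7] -/
theorem endAlg.isUnit_transposeLinear_iff (a : H.endAlg) : IsUnit (endAlg.transposeLinear H a) ↔ IsUnit a := by
  rw [← isUnit_op]
  exact MulEquiv.isUnit_map (endAlg.transposeAlgEquiv H).toMulEquiv

/-- The units correspond: `Aut_MHS(H) ≃* (Aut_MHS(H^∨))ᵐᵒᵖ`-flavoured equivalence `(End_MHS H)ˣ ≃* ((End_MHS H^∨)ᵐᵒᵖ)ˣ`.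
[cite: CattaniElZeinGriffithsLe2014, §3.2.2.7] -/
def endAlg.unitsTransposeEquiv : (H.endAlg)ˣ ≃* ((H.dual.endAlg)ᵐᵒᵖ)ˣ :=
  Units.mapEquiv (endAlg.transposeAlgEquiv H).toMulEquiv

/-- **`End_MHS(H^∨)` is commutative iff `End_MHS(H)` is.** [cite: CattaniElZeinGriffithsLe2014, §3.2.2.7] -/
theorem endAlg.forall_mul_comm_dual_iff :
    (∀ b b' : H.dual.endAlg, b * b' = b' * b) ↔ ∀ a a' : H.endAlg, a * a' = a' * a := by
  constructor
  · intro h a a'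
    apply endAlg.transposeLinear_injective H
    rw [endAlg.transposeLinear_mul, endAlg.transposeLinear_mul, h]
  · intro h b b'
    obtain ⟨a, rfl⟩ := (endAlg.transposeLinear_bijective H).2 b
    obtain ⟨a', rfl⟩ := (endAlg.transposeLinear_bijective H).2 b'
    rw [← endAlg.transposeLinear_mul, ← endAlg.transposeLinear_mul, h]

/-- **`End_MHS(H^∨)` is reduced iff `End_MHS(H)` is** (nilpotents correspond under `a ↦ a^∨`). [cite: CattaniElZeinGriffithsLe2014, §3.2.2.7] -/
theorem endAlg.isReduced_dual_iff : IsReduced H.dual.endAlg ↔ IsReduced H.endAlg := by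
  constructor
  · intro h
    exact ⟨fun a ha => endAlg.transposeLinear_injective H (by
      rw [map_zero]; exact h.eq_zero _ ((endAlg.isNilpotent_transposeLinear_iff H a).2 ha))⟩
  · intro h
    refine ⟨fun b hb => ?_⟩
    obtain ⟨a, rfl⟩ := (endAlg.transposeLinear_bijective H).2 b
    rw [h.eq_zero a ((endAlg.isNilpotent_transposeLinear_iff H a).1 hb), map_zero]

/-- Local rings are preserved by passing to the opposite ring. [cite: Lam2001FirstCourse, (19.1)] -/
private theorem isLocalRing_mulOpposite_iff {A : Type*} [Semiring A] : IsLocalRing Aᵐᵒᵖ ↔ IsLocalRing A := by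
  constructor
  · intro h
    haveI : Nontrivial A := MulOpposite.unop_injective.nontrivial
    refine IsLocalRing.of_is_unit_or_is_unit_of_add_one fun {a b} hab => ?_
    have h1 : MulOpposite.op a + MulOpposite.op b = 1 := by rw [← MulOpposite.op_add, hab, MulOpposite.op_one]
    rcases IsLocalRing.isUnit_or_isUnit_of_add_one h1 with ha | hb
    · exact Or.inl (isUnit_op.1 ha)
    · exact Or.inr (isUnit_op.1 hb)
  · intro h
    haveI : Nontrivial Aᵐᵒᵖ := MulOpposite.op_injective.nontrivial
    refine IsLocalRing.of_is_unit_or_is_unit_of_add_one fun {a b} hab => ?_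
    have h1 : MulOpposite.unop a + MulOpposite.unop b = 1 := by rw [← MulOpposite.unop_add, hab, MulOpposite.unop_one]
    rcases IsLocalRing.isUnit_or_isUnit_of_add_one h1 with ha | hb
    · exact Or.inl (isUnit_unop.1 ha)
    · exact Or.inr (isUnit_unop.1 hb)

/-- Local rings transport along ring isomorphisms. [cite: Lam2001FirstCourse, (19.1)] -/
private theorem isLocalRing_of_ringEquiv' {A B : Type*} [Semiring A] [Semiring B] (f : A ≃+* B) (hA : IsLocalRing A) :
    IsLocalRing B := by
  haveI := hA
  haveI : Nontrivial B := f.injective.nontrivial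
  refine IsLocalRing.of_is_unit_or_is_unit_of_add_one fun {a b} hab => ?_
  have h : f.symm a + f.symm b = 1 := by rw [← map_add, hab, map_one]
  rcases IsLocalRing.isUnit_or_isUnit_of_add_one h with ha | hb
  · exact Or.inl (by simpa using ha.map f)
  · exact Or.inr (by simpa using hb.map f)

/-- **`End_MHS(H^∨)` is a local ring iff `End_MHS(H)` is** (equivalently, by Lam (19.17): `H^∨` is indecomposable iff `H` is —
the tree's `isIndecomposable_dual_iff`, here recovered ring-theoretically). [cite: Lam2001FirstCourse, Thm. (19.17)]
[cite: Fujiki1980, (1.6.2) a)] -/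
theorem endAlg.isLocalRing_dual_iff : IsLocalRing H.dual.endAlg ↔ IsLocalRing H.endAlg :=
  ⟨fun h => isLocalRing_mulOpposite_iff.1 (isLocalRing_of_ringEquiv' (endAlg.dualRingEquivOp H) h),
    fun h => isLocalRing_of_ringEquiv' (endAlg.dualRingEquivOp H).symm (isLocalRing_mulOpposite_iff.2 h)⟩

/-- **`End_MHS(H^∨)` is a semisimple ring iff `End_MHS(H)` is.** [cite: CattaniElZeinGriffithsLe2014, §3.2.2.7] -/
theorem endAlg.isSemisimpleRing_dual_iff : IsSemisimpleRing H.dual.endAlg ↔ IsSemisimpleRing H.endAlg := by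
  rw [(endAlg.dualRingEquivOp H).isSemisimpleRing_iff, isSemisimpleRing_mulOpposite_iff]

/-- **`End_MHS(H^∨)` is a simple ring iff `End_MHS(H)` is.** [cite: CattaniElZeinGriffithsLe2014, §3.2.2.7] -/
theorem endAlg.isSimpleRing_dual_iff : IsSimpleRing H.dual.endAlg ↔ IsSimpleRing H.endAlg := by
  constructor
  · intro h
    haveI := IsSimpleRing.of_ringEquiv (endAlg.dualRingEquivOp H) h
    exact IsSimpleRing.of_ringEquiv (RingEquiv.opOp H.endAlg).symm inferInstance
  · intro h
    haveI := h
    exact IsSimpleRing.of_ringEquiv (endAlg.dualRingEquivOp H).symm inferInstance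

/-- Hence for `H` and `H^∨` simultaneously: `rad End_MHS(H^∨) = 0 ↔ rad End_MHS(H) = 0` (both algebras are Artinian).
[cite: CattaniElZeinGriffithsLe2014, §3.2.2.7] -/
theorem endAlg.jacobson_dual_eq_bot_iff : Ring.jacobson H.dual.endAlg = ⊥ ↔ Ring.jacobson H.endAlg = ⊥ := by
  haveI := isArtinianRing_endAlg H
  haveI := isArtinianRing_endAlg H.dual
  rw [← IsArtinianRing.isSemisimpleRing_iff_jacobson, ← IsArtinianRing.isSemisimpleRing_iff_jacobson,
    endAlg.isSemisimpleRing_dual_iff]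

end MixedHodgeStructure

end Literature.AlgebraicGeometry.Motives
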